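import Summits.BirchSwinnertonDyer.BirchSwinnertonDyer.Theorems.PrintCf2RubinValueTwoLinePinDefectClass
import Summits.BirchSwinnertonDyer.BirchSwinnertonDyer.Theorems.PrintCf2RubinValueTwoLinePinSlotOneIdentity
import Summits.BirchSwinnertonDyer.BirchSwinnertonDyer.Theorems.PrintCf2RubinValueTwoLinePinDefectTorsionOfEulerFactor
import HarnessLib

/-!
# M-LINE-PIN, (C)∘(C2b) part 7: THE `v`-LINE CONTROL IDENTITY WITH THE `v̄`-DEFECT COMPUTED —
# `π_v(ch_{Λ₂} D₂.X) = ((1+T) − u)^{corank_{ℤ_p}(coker g)} · ch_Λ(D₁.X)`, `D₂.X` torsion DISCHARGED from `D₁.X` torsion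

Cell `bsd-print-cf2`, width seat `bsd-line-cf2c-w8` g4 (prover-bsd-line-cf2c-w8-g4-0), planner g19's named piece M-LINE-PIN
(memo `Cruxes/TwoVariableMainConjAtSplitTwo/M-LINE-PIN-cf2c-w8g3.md` §2/§8; skeleton SPEC `M-LINE-PIN-SKELETON-SPEC-g19.md` §1: the first-slot
identity `hline` is `(C) ∘ (C2b) ∘ (L)`). This file is the JUNCTION `(C) ∘ (C2b)`: cf2c-w8 g3's kernel-form identity (C5)
`LinePinControl.charIdeal_map_eq_mul_of_slotOne_control` (`π(ch D₂.X) = ch(ker φ̄) · ch(D₁.X)`) composed with this seat's (C2b) parts 1–6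
(`ch(ker φ̄) = ((1+T) − u)^{corank_{ℤ_p} C}` for any presentation `πC : H¹_nr(K̃_∞, M)^{γ₂=1} ↠ C` of the cokernel of the slot-1 control `g`, when
`v̄ = 𝔮` is undecomposed in the line and `τ ∈ D_𝔮` acts on `M` as the integer `u ≡ 1 (mod p)`) and cf2c-w2 g4's torsion transfer
`LinePinDefect.isTorsion₂_of_slotOne_control_of_decomp` (`D₁.X` torsion ⟹ `D₂.X` torsion). `--supports stmt-BirchSwinnertonDyer-24086 --as helper`,
Theses-free. HONEST FRAMING: assembly; the displayed inputs that remain are `[Finite g.ker]` ((C1) `finite_ker_lineRes_unr` discharges it from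
`M^{pairKer}⧸(γ₂−1)` finite), `(ch_{Λ₂} D₂.X)(T₁,0) ≠ 0`, S3n′ (item 24037, `hfin`), (LS)_v (as the exponent `corank_{ℤ_p} C`), the EVEN local
class `hI`, and the print `D₁.X` torsion ((M), Müller 2020 on the uncrossed `v`-line). No summit statement is proved by this seat; BSD is not proved
by any of this. THEOREMS ONLY (no definition, no named fact, no `sorry`).

* `map_charIdeal_eq_span_pow_zpCorank_mul` — generic `𝔮 ∣ p`: `IsTorsion Λ₂ D₂.X ∧ Finite C[p] ∧
  π(ch_{Λ₂} D₂.X) = span {((1+T) − u)} ^ corank_{ℤ_p} C * ch_Λ D₁.X`.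
* `map_charIdeal_eq_span_mul_of_zpCorank_eq_one` — the (LS)_v = 1 form: `π(ch_{Λ₂} D₂.X) = span {(1+T) − u} * ch_Λ D₁.X`.
* `exists_map_charIdeal_eq_span_pow_zpCorank_mul_of_frame` — THE CLASS FORM on the road-α frame (`K` imaginary quadratic, `θ_K² = −7`,
  `C • W = cm7^{(d)}`, `2 = v v̄`, `κ₁` the `v`-line, `κ₂` unramified outside `v̄`, `M = A_θ` with `θ² = 1`): `∃ τ ∈ D_{v̄}, ∃ u ∈ {±1}, κ₁ τ = κ₁ γ₁ ∧
  τ = u on A_θ ∧ IsTorsion Λ₂ D₂.X ∧ Finite C[2] ∧ π(ch_{Λ₂} D₂.X) = span {(1+T) − u} ^ corank_{ℤ₂} C * ch_Λ D₁.X` (`E_v̄ = T` or `T + 2`).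
presearch: as parts 1–6 (Greenberg–Vatsal 2000 Prop. (2.4), Greenberg LNM 1716 §3–4, Washington §13) — assembly. beyond-print theorem: no.

References: [GreenbergVatsal2000] §2 Cor. (2.3), Prop. (2.4); [GreenbergLNM1716] §1, §3–4; [Washington1997] §13.1–13.2; [Rubin1991] §4–5.
-/

noncomputable section

open scoped Classical Pointwise AddSubgroup NumberField

-- the summit namespace `Summit.BirchSwinnertonDyer.BirchSwinnertonDyer` repeats the problem name by design (D-0017)
set_option linter.dupNamespace false
set_option autoImplicit false

open NumberField IsDedekindDomain Field WeierstrassCurve Literature.NumberTheory.GaloisRepresentations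
  Literature.NumberTheory.EllipticCurves Literature.NumberTheory.EllipticCurves.Module
  Literature.NumberTheory.EllipticCurves.IwasawaAlgebra Literature.NumberTheory.EllipticCurves.GreenbergSelmer
  Literature.NumberTheory.EllipticCurves.GreenbergVatsal2000 Literature.NumberTheory.EllipticCurves.KellerYin2024
  Literature.NumberTheory.EllipticCurves.IwasawaDual
open Summit.BirchSwinnertonDyer.BirchSwinnertonDyer.Theorems.PrintCf2

namespace Summit.BirchSwinnertonDyer.BirchSwinnertonDyer.Theorems.PrintCf2.LinePin

/-! ## §1. Generic `𝔮 ∣ p`, undecomposed in the line -/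

section Generic

variable {K : Type} [Field K] [NumberField K] {p : ℕ} [Fact p.Prime] {κ κ₂ : ZpExtension K p}
  {M : Type} [AddCommGroup M] [DistribMulAction (absoluteGaloisGroup K) M] [TopologicalSpace M] [DiscreteTopology M]
  {𝔮 : HeightOneSpectrum (𝓞 K)} {γ γ₂ : absoluteGaloisGroup K}
  {g : unrSelmer κ M 𝔮 ∅ →+ unrSelmer₂ κ κ₂ M 𝔮}
  (hg : ∀ t : unrSelmer κ M 𝔮 ∅,
    ((g t : unrSelmer₂ κ κ₂ M 𝔮) : subgroupH1 (ZpExtension.pairKer κ κ₂) M) =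
      resOfLe M (ZpExtension.pairKer_le_left κ κ₂) (t : subgroupH1 κ.kerSubgroup M))
  {D₂ : DualData₂ κ κ₂ M 𝔮 γ γ₂} {D₁ : DatumDualData κ γ M (Castella2018.AcSelmer.bdpData M p 𝔮) ∅}
  {φ : D₂.X →ₛₗ[PowerSeries.map (PowerSeries.constantCoeff (R := ℤ_[p]))] D₁.X}
  (hφ : ∀ (x : D₂.X) (t : unrSelmer κ M 𝔮 ∅), D₁.toDual (φ x) t = D₂.toDual x (g t))
include hg hφ

/-- **THE `v`-LINE CONTROL IDENTITY WITH THE `v̄`-DEFECT COMPUTED ((C) ∘ (C2b)).** For a generator pair `(κ, κ₂; γ, γ₂)`, `M` discrete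
`p`-primary with continuous orbits, `κ₂` unramified outside `𝔮 ∣ p`, the inertia `pairKer ⊓ I_𝔮` acting trivially on `M` (even local class),
`𝔮` UNDECOMPOSED in the line (`τ ∈ D_𝔮` with `κ τ = κ γ`) with `τ` acting on `M` as `u ≡ 1 (mod p)`, the slot-1 control `g` (finite kernel) with
transpose `φ` and a presentation `πC` of `coker(g)|_{γ₂-invariants}`; if `D₂.X` is f.g., `D₁.X` is `Λ`-torsion, `π(ch_{Λ₂} D₂.X) ≠ 0` and every
pseudo-null submodule of `D₂.X` is finite (S3n′), then `D₂.X` is `Λ₂`-torsion, `C[p]` is finite and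
**`π(charIdeal Λ₂ D₂.X) = span {((1+T) − u)} ^ corank_{ℤ_p} C * charIdeal Λ D₁.X`.**
[cite: GreenbergVatsal2000, §2 Cor. (2.3), Prop. (2.4) (p. 22)] [cite: GreenbergLNM1716, §3 Lemmas 3.1–3.2, §4 Lemma 4.2] [cite: Washington1997, §13.2] -/
theorem map_charIdeal_eq_span_pow_zpCorank_mul [Module.Finite (IwasawaAlgebra₂ p) D₂.X] [Finite g.ker]
    (hγ : ZpExtension.IsTopGeneratorPair κ κ₂ γ γ₂)
    (hcont : ∀ m : M, Continuous fun σ : absoluteGaloisGroup K ↦ σ • m) (hprim : ∀ m : M, ∃ k : ℕ, p ^ k • m = 0)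
    (hκ₂ : κ₂.IsUnramifiedOutside 𝔮) (h𝔮 : ((p : ℕ) : 𝓞 K) ∈ 𝔮.asIdeal)
    (hI : ∀ y : absoluteGaloisGroup K, y ∈ ZpExtension.pairKer κ κ₂ → y ∈ inertia 𝔮 → ∀ m : M, y • m = m)
    {τ : absoluteGaloisGroup K} (hτ : τ ∈ decomp 𝔮) (hκτ : κ τ = κ γ) {u : ℤ} (hu : ∀ m : M, τ • m = u • m)
    (hpu : (p : ℤ) ∣ u - 1)
    {C : Type*} [AddCommGroup C] (πC : ↥(endInvariants (conjSel₂ κ κ₂ M 𝔮 γ₂ - 1)) →+ C) (hsurj : Function.Surjective πC)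
    (hker : ∀ s : ↥(endInvariants (conjSel₂ κ κ₂ M 𝔮 γ₂ - 1)), πC s = 0 ↔ (s : unrSelmer₂ κ κ₂ M 𝔮) ∈ g.range)
    (hD₁ : Module.IsTorsion (IwasawaAlgebra p) D₁.X)
    (hne : (charIdeal (IwasawaAlgebra₂ p) D₂.X).map (PowerSeries.map (PowerSeries.constantCoeff (R := ℤ_[p]))) ≠ ⊥)
    (hfin : ∀ N : Submodule (IwasawaAlgebra₂ p) D₂.X, Module.IsPseudoNull (IwasawaAlgebra₂ p) N → Finite N) :
    Module.IsTorsion (IwasawaAlgebra₂ p) D₂.X ∧ Finite (C[(p : ℤ)]) ∧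
      (charIdeal (IwasawaAlgebra₂ p) D₂.X).map (PowerSeries.map (PowerSeries.constantCoeff (R := ℤ_[p]))) =
        Ideal.span {((1 : IwasawaAlgebra p) + PowerSeries.X) - (u : IwasawaAlgebra p)} ^ zpCorank C p *
          charIdeal (IwasawaAlgebra p) D₁.X := by
  letI instQ : Module (IwasawaAlgebra p) (QuotSMulTop (PowerSeries.C (PowerSeries.X : IwasawaAlgebra p) : IwasawaAlgebra₂ p) D₂.X) :=
    Module.compHom _ (PowerSeries.map (PowerSeries.C (R := ℤ_[p])))
  -- two-variable torsion from one-variable torsion (cf2c-w2 g4, via part 1's Euler-factor annihilator with `n = 1`)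
  have hκτ1 : κ τ = κ (γ ^ 1) := by rw [pow_one]; exact hκτ
  have htors : Module.IsTorsion (IwasawaAlgebra₂ p) D₂.X :=
    LinePinDefect.isTorsion₂_of_slotOne_control_of_decomp hg hφ hγ hcont hprim hκ₂ h𝔮 hI hτ one_ne_zero hκτ1 hu hD₁
  -- (C5): the kernel-form identity
  obtain ⟨φbar, hφbar, hid, -⟩ := LinePinControl.charIdeal_map_eq_mul_of_slotOne_control hg hφ htors hne hfin
  -- (C2b): the defect term
  obtain ⟨hfinC, -⟩ := finite_torsionBy_and_zpCorank_eq_lambdaInvariant_ker_liftQ hg hφ hγ hcont hprim hκ₂ h𝔮 hI hτ hκτ hu hpu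
    πC hsurj hker φbar hφbar
  refine ⟨htors, hfinC, ?_⟩
  rw [hid, charIdeal_ker_liftQ_eq_span_pow_zpCorank hg hφ hγ hcont hprim hκ₂ h𝔮 hI hτ hκτ hu hpu πC hsurj hker φbar hφbar]

/-- **(LS)_v = 1 FORM: `π(charIdeal Λ₂ D₂.X) = ((1+T) − u) · charIdeal Λ D₁.X`** — the first-slot identity of M-LINE-PIN with the Euler factor
at `v̄` in place, as soon as the cokernel of the slot-1 control has `ℤ_p`-corank one. [cite: GreenbergVatsal2000, §2 Prop. (2.4) (p. 22)]
[cite: GreenbergLNM1716, §4 Lemma 4.2] -/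
theorem map_charIdeal_eq_span_mul_of_zpCorank_eq_one [Module.Finite (IwasawaAlgebra₂ p) D₂.X] [Finite g.ker]
    (hγ : ZpExtension.IsTopGeneratorPair κ κ₂ γ γ₂)
    (hcont : ∀ m : M, Continuous fun σ : absoluteGaloisGroup K ↦ σ • m) (hprim : ∀ m : M, ∃ k : ℕ, p ^ k • m = 0)
    (hκ₂ : κ₂.IsUnramifiedOutside 𝔮) (h𝔮 : ((p : ℕ) : 𝓞 K) ∈ 𝔮.asIdeal)
    (hI : ∀ y : absoluteGaloisGroup K, y ∈ ZpExtension.pairKer κ κ₂ → y ∈ inertia 𝔮 → ∀ m : M, y • m = m)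
    {τ : absoluteGaloisGroup K} (hτ : τ ∈ decomp 𝔮) (hκτ : κ τ = κ γ) {u : ℤ} (hu : ∀ m : M, τ • m = u • m)
    (hpu : (p : ℤ) ∣ u - 1)
    {C : Type*} [AddCommGroup C] (πC : ↥(endInvariants (conjSel₂ κ κ₂ M 𝔮 γ₂ - 1)) →+ C) (hsurj : Function.Surjective πC)
    (hker : ∀ s : ↥(endInvariants (conjSel₂ κ κ₂ M 𝔮 γ₂ - 1)), πC s = 0 ↔ (s : unrSelmer₂ κ κ₂ M 𝔮) ∈ g.range)
    (hLS : zpCorank C p = 1)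
    (hD₁ : Module.IsTorsion (IwasawaAlgebra p) D₁.X)
    (hne : (charIdeal (IwasawaAlgebra₂ p) D₂.X).map (PowerSeries.map (PowerSeries.constantCoeff (R := ℤ_[p]))) ≠ ⊥)
    (hfin : ∀ N : Submodule (IwasawaAlgebra₂ p) D₂.X, Module.IsPseudoNull (IwasawaAlgebra₂ p) N → Finite N) :
    Module.IsTorsion (IwasawaAlgebra₂ p) D₂.X ∧
      (charIdeal (IwasawaAlgebra₂ p) D₂.X).map (PowerSeries.map (PowerSeries.constantCoeff (R := ℤ_[p]))) =
        Ideal.span {((1 : IwasawaAlgebra p) + PowerSeries.X) - (u : IwasawaAlgebra p)} * charIdeal (IwasawaAlgebra p) D₁.X := by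
  obtain ⟨htors, -, hid⟩ := map_charIdeal_eq_span_pow_zpCorank_mul hg hφ hγ hcont hprim hκ₂ h𝔮 hI hτ hκτ hu hpu πC hsurj hker
    hD₁ hne hfin
  exact ⟨htors, by rw [hid, hLS, pow_one]⟩

end Generic

/-! ## §2. The class form on the road-α frame (`K = ℚ(√−7)`, `p = 2`, `M = A_θ`, `θ² = 1`) -/

section Frame

variable {K : Type} [Field K] [NumberField K]

/-- **THE CLASS FORM OF THE FIRST-SLOT IDENTITY.** On the frame (`K` imaginary quadratic, `θ_K² = −7`, `C_W • W = cm7^{(d)}`, `v ≠ v̄` above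
`2`), for the `v`-line `κ₁` (unramified outside `v`), a partner `κ₂` unramified outside `v̄`, a generator pair, a quadratic `θ` with
`pairKer ⊓ I_{v̄}` trivial on `A_θ` (even local class), the slot-1 control `g` (finite kernel) with transpose `φ` into a Greenberg–Vatsal datum
`D₁` with `D₁.X` `Λ`-TORSION, `D₂.X` f.g. with `π(ch D₂.X) ≠ 0` and S3n′, and a presentation `πC` of `coker(g)|_{γ₂-invariants}`:
`∃ τ ∈ D_{v̄}, ∃ u ∈ {1, −1}, κ₁ τ = κ₁ γ₁ ∧ τ = u on A_θ ∧ D₂.X torsion ∧ C[2] finite ∧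
π(charIdeal Λ₂ D₂.X) = span {(1+T) − u} ^ corank_{ℤ₂} C * charIdeal Λ D₁.X` — the Euler factor at `v̄` is `T` (`u = 1`) or `T + 2` (`u = −1`).
[cite: GreenbergVatsal2000, §2 Prop. (2.4) (p. 22)] [cite: GreenbergLNM1716, §4 Lemma 4.2] [cite: KellerYin2024, §1.1] -/
theorem exists_map_charIdeal_eq_span_pow_zpCorank_mul_of_frame (hK : IsImaginaryQuadratic K) {θK : K} (hθK : θK ^ 2 = -7) {d : ℤ}
    (hd0 : d ≠ 0) (W : WeierstrassCurve ℚ) [W.IsElliptic] {CW : VariableChange ℚ} (hCW : CW • W = cm7.quadraticTwist (d : ℚ))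
    {v vbar : HeightOneSpectrum (𝓞 K)} (hv : ((2 : ℕ) : 𝓞 K) ∈ v.asIdeal) (hvbar : ((2 : ℕ) : 𝓞 K) ∈ vbar.asIdeal) (hne : vbar ≠ v)
    {κ₁ κ₂ : ZpExtension K 2} (hκ₁ : κ₁.IsUnramifiedOutside v) (hκ₂ : κ₂.IsUnramifiedOutside vbar)
    {γ₁ γ₂ : absoluteGaloisGroup K} (hγ : ZpExtension.IsTopGeneratorPair κ₁ κ₂ γ₁ γ₂)
    (θ : FramedGaloisRep K (padicCoeffIntegers (∅ : Set (PadicAlgCl 2))) 1) (hθ2 : ∀ σ, θ σ ^ 2 = 1)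
    (hI : ∀ y : absoluteGaloisGroup K, y ∈ ZpExtension.pairKer κ₁ κ₂ → y ∈ inertia vbar →
      ∀ m : charModule (∅ : Set (PadicAlgCl 2)) θ, y • m = m)
    {g : unrSelmer κ₁ (charModule (∅ : Set (PadicAlgCl 2)) θ) vbar ∅ →+ unrSelmer₂ κ₁ κ₂ (charModule (∅ : Set (PadicAlgCl 2)) θ) vbar}
    (hg : ∀ t : unrSelmer κ₁ (charModule (∅ : Set (PadicAlgCl 2)) θ) vbar ∅,
      ((g t : unrSelmer₂ κ₁ κ₂ (charModule (∅ : Set (PadicAlgCl 2)) θ) vbar) :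
          subgroupH1 (ZpExtension.pairKer κ₁ κ₂) (charModule (∅ : Set (PadicAlgCl 2)) θ)) =
        resOfLe (charModule (∅ : Set (PadicAlgCl 2)) θ) (ZpExtension.pairKer_le_left κ₁ κ₂)
          (t : subgroupH1 κ₁.kerSubgroup (charModule (∅ : Set (PadicAlgCl 2)) θ)))
    [Finite g.ker]
    {D₂ : DualData₂ κ₁ κ₂ (charModule (∅ : Set (PadicAlgCl 2)) θ) vbar γ₁ γ₂} [Module.Finite (IwasawaAlgebra₂ 2) D₂.X]
    {D₁ : DatumDualData κ₁ γ₁ (charModule (∅ : Set (PadicAlgCl 2)) θ)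
      (Castella2018.AcSelmer.bdpData (charModule (∅ : Set (PadicAlgCl 2)) θ) 2 vbar) ∅}
    {φ : D₂.X →ₛₗ[PowerSeries.map (PowerSeries.constantCoeff (R := ℤ_[2]))] D₁.X}
    (hφ : ∀ (x : D₂.X) (t : unrSelmer κ₁ (charModule (∅ : Set (PadicAlgCl 2)) θ) vbar ∅), D₁.toDual (φ x) t = D₂.toDual x (g t))
    {C : Type*} [AddCommGroup C]
    (πC : ↥(endInvariants (conjSel₂ κ₁ κ₂ (charModule (∅ : Set (PadicAlgCl 2)) θ) vbar γ₂ - 1)) →+ C) (hsurj : Function.Surjective πC)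
    (hker : ∀ s : ↥(endInvariants (conjSel₂ κ₁ κ₂ (charModule (∅ : Set (PadicAlgCl 2)) θ) vbar γ₂ - 1)),
      πC s = 0 ↔ (s : unrSelmer₂ κ₁ κ₂ (charModule (∅ : Set (PadicAlgCl 2)) θ) vbar) ∈ g.range)
    (hD₁ : Module.IsTorsion (IwasawaAlgebra 2) D₁.X)
    (hne0 : (charIdeal (IwasawaAlgebra₂ 2) D₂.X).map (PowerSeries.map (PowerSeries.constantCoeff (R := ℤ_[2]))) ≠ ⊥)
    (hfin : ∀ N : Submodule (IwasawaAlgebra₂ 2) D₂.X, Module.IsPseudoNull (IwasawaAlgebra₂ 2) N → Finite N) :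
    ∃ τ ∈ decomp vbar, ∃ u : ℤ, κ₁ τ = κ₁ γ₁ ∧ (u = 1 ∨ u = -1) ∧
      (∀ m : charModule (∅ : Set (PadicAlgCl 2)) θ, τ • m = u • m) ∧
      Module.IsTorsion (IwasawaAlgebra₂ 2) D₂.X ∧ Finite (C[(2 : ℤ)]) ∧
      (charIdeal (IwasawaAlgebra₂ 2) D₂.X).map (PowerSeries.map (PowerSeries.constantCoeff (R := ℤ_[2]))) =
        Ideal.span {((1 : IwasawaAlgebra 2) + PowerSeries.X) - (u : IwasawaAlgebra 2)} ^ zpCorank C 2 *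
          charIdeal (IwasawaAlgebra 2) D₁.X := by
  -- `v̄` is undecomposed in the `v`-line (part 5)
  obtain ⟨τ, hτ, hκτ⟩ := exists_mem_decomp_vbar_apply_eq_of_isUnramifiedOutside hK hθK hd0 W hCW hv hvbar hne κ₁ hκ₁ hγ.left
  -- `τ` acts on `A_θ` by `u = ±1` (part 6)
  obtain ⟨u, hu1, hpu, hu⟩ := exists_int_smul_charModule_of_sq_eq_one θ (hθ2 τ)
  -- the module `A_θ` is `2`-primary with continuous orbits
  have hcont : ∀ m : charModule (∅ : Set (PadicAlgCl 2)) θ, Continuous fun σ : absoluteGaloisGroup K ↦ σ • m :=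
    fun m ↦ CharResidualSelmerCount.continuous_smul_charModule θ m
  have hprim : ∀ m : charModule (∅ : Set (PadicAlgCl 2)) θ, ∃ k : ℕ, 2 ^ k • m = 0 :=
    fun m ↦ exists_pow_smul_cofree_eq_zero (∅ : Set (PadicAlgCl 2)) θ m
  exact ⟨τ, hτ, u, hκτ, hu1, hu, map_charIdeal_eq_span_pow_zpCorank_mul hg hφ hγ hcont hprim hκ₂ hvbar hI hτ hκτ hu hpu πC hsurj hker
    hD₁ hne0 hfin⟩

end Frame

end Summit.BirchSwinnertonDyer.BirchSwinnertonDyer.Theorems.PrintCf2.LinePin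

end
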